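import Summits.QuantumFields.QCD.Theorems.QuarksAsStableActionStableActionBridgeSliceMassHopPosDef
import Summits.QuantumFields.QCD.Theorems.QuarksAsStableActionStableActionBridgeSliceNilpotent
import Summits.QuantumFields.QCD.Theorems.QuarksAsStableActionStableActionBridgeTimeKernelPosDef
import Summits.QuantumFields.QCD.Theorems.QuarksAsStableActionStableActionBridgeFockLiftPosDef

/-!
# Lüscher positivity of the fermionic transfer operator of lattice QCD with `r = 1` Wilson quarks
(crux `QuarksAsStableAction.StableActionBridge`, item stmt-QuantumFields-9737, line `Sketch`; lead assembly of
continuation lead c3, cycle 4, `--supports stmt-QuantumFields-9737`; registered sub-goals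
`fermionSliceMatrix_posDef`, `fermionSliceOp_posDef`)

For every number of flavours `N_f`, every spatial three-torus of side `S ≥ 1`, every `SU(3)` background `U` on
its links and all bare masses `m_f > −1` (hopping parameters `κ_f = 1/(2m_f + 8) < 1/6`, Lüscher's condition,
Montvay–Münster (4.111)):

* `fermionSliceMatrix_posDef` — Smit's one-particle matrix of the fermionic one-step transfer operator,
  `M_F(U) = (1 − N)(A⁻¹ ⊗ P⁺ + A ⊗ P⁻)(1 − N)ᴴ` (`fermionSliceMatrix`, Smit (6.91)), is Hermitian positive
  definite;
* `fermionSliceOp_posDef` — the fermionic transfer operator itself, `T̂_F(U) = (det A)² · Γ(M_F(U))`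
  (`fermionSliceOp`) on the Fock space of the slice quark modes, is Hermitian positive definite;
* `fermionWeightForm_self_re_nonneg` — consequently the `T̂_F`-weighted pairing `𝔫(Ψ, Ψ) = ∫ ⟨Ψ(U), T̂_F(U)Ψ(U)⟩ dU`
  (`fermionWeightForm`, the denominator of the Rayleigh quotient `transferRayleigh` behind `qcdTransferGap`) has
  non-negative real part on the diagonal for every wave function `Ψ`.

These are the positivity assertions made (without proof) in the docstrings of `fermionSliceOp` and
`qcdTransferGap` of `Literature/MathematicalPhysics/QuantumFieldTheory/QCDTransferMatrix.lean`; they are the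
fermionic half of Lüscher's theorem that the transfer matrix of Wilson's lattice QCD is bounded, self-adjoint and
strictly positive for `|κ| < 1/6` — the input F3 of this line's transfer from the antiperiodic-even family (where
the chessboard bound A is typed) to the statement's time-periodic odd tori (atoms p103562, p103305, p106608,
p109817 consume a positive `TransferData`).

Assembly (no new mathematics here) of the four worker files of wave 1 of cycle 4:
`sliceMassHop_posDef` (p119308: `A = diag(m_f + 4) − ½Σ_j(W_j + W_jᴴ) > 0`, sum of squares over isometric hops),
`sliceNilp_mul_self_and_isUnit` (p119436: `N² = 0`, `1 − N` a unit), `posDef_timeKernel` (p119276: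
`A⁻¹ ⊗ P⁺ + A ⊗ P⁻ > 0`), `fockLift_posDef` (p119264: `Γ` of a positive definite matrix is positive definite,
`Γ = fockLift = Gamma` multiplicative), together with Mathlib's `Matrix.IsUnit.posDef_star_right_conjugate_iff`,
`Matrix.PosDef.submatrix`, `Matrix.PosDef.det_pos`, `Matrix.PosDef.smul`.

References: M. Lüscher, Commun. Math. Phys. 54 (1977) 283 [Luscher1977, pp. 283–292]; J. Smit, *Introduction to
Quantum Fields on a Lattice*, §6.5 (6.84)–(6.91) [Smit2023]; I. Montvay, G. Münster, *Quantum Fields on a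
Lattice*, §4.2.3 (4.111) [MontvayMunster1994].
-/

noncomputable section

namespace Summit.QuantumFields.QCD.Cruxes.StableActionBridge.Sketch

open scoped ComplexOrder
open MeasureTheory Matrix
open Literature.MathematicalPhysics.QuantumFieldTheory Literature.MathematicalPhysics.QuantumLattice

/-- **Positivity of the one-particle transfer matrix** (registered sub-goal `fermionSliceMatrix_posDef` of crux
stmt-QuantumFields-9737).  For all bare masses `m_f > −1`, Smit's one-particle matrix
`M_F(U) = (1 − N)(A⁻¹ ⊗ P⁺ + A ⊗ P⁻)(1 − N)ᴴ` of the fermionic transfer operator of `r = 1` Wilson quarks in the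
background `U` is Hermitian positive definite: the middle factor is positive definite (`posDef_timeKernel` with
`A = sliceMassHop U m > 0`, `sliceMassHop_posDef`) and `1 − N` is a unit (`sliceNilp_mul_self_and_isUnit`).
[cite: Smit2023, §6.5 (6.91)] [cite: Luscher1977, pp. 283–292] -/
theorem fermionSliceMatrix_posDef :
    ∀ (Nf S : ℕ) [NeZero S] (U : GaugeConfig 3 S (Matrix.specialUnitaryGroup (Fin 3) ℂ)) (mq : Fin Nf → ℝ),
      (∀ f, -1 < mq f) → (fermionSliceMatrix U mq).PosDef := by
  intro Nf S _ U mq hm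
  have hA := sliceMassHop_posDef Nf S U mq hm
  have hK := posDef_timeKernel Nf S _ hA
  obtain ⟨-, hN⟩ := sliceNilp_mul_self_and_isUnit Nf S U
  unfold fermionSliceMatrix
  have h := (Matrix.IsUnit.posDef_star_right_conjugate_iff
    (x := sliceKron (sliceMassHop U mq)⁻¹ timeProjPlus + sliceKron (sliceMassHop U mq) timeProjMinus) hN).mpr hK
  rw [Matrix.star_eq_conjTranspose, Matrix.conjTranspose_sub, Matrix.conjTranspose_one] at h
  exact h

/-- **Lüscher positivity of the fermionic transfer operator** (registered sub-goal `fermionSliceOp_posDef` of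
crux stmt-QuantumFields-9737).  For all bare masses `m_f > −1` (`κ_f < 1/6`) and every `SU(3)` background `U` on
the spatial three-torus, `T̂_F(U) = (det A)² · Γ(M_F(U))` is Hermitian positive definite on the Fock space of the
slice quark modes: `Γ(M_F) > 0` by `fockLift_posDef` and `fermionSliceMatrix_posDef` (positivity is stable under
the reindexing `sliceQuarkEquiv`), and `(det A)² > 0` since `A > 0` (`sliceMassHop_posDef`, `PosDef.det_pos`).
[cite: Luscher1977, pp. 283–292] [cite: Smit2023, §6.5 (6.84) and (6.91)] [cite: MontvayMunster1994, §4.2.3 (4.111)] -/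
theorem fermionSliceOp_posDef :
    ∀ (Nf S : ℕ) [NeZero S] (U : GaugeConfig 3 S (Matrix.specialUnitaryGroup (Fin 3) ℂ)) (mq : Fin Nf → ℝ),
      (∀ f, -1 < mq f) → (fermionSliceOp U mq).PosDef := by
  intro Nf S _ U mq hm
  have hM := fermionSliceMatrix_posDef Nf S U mq hm
  have hA := sliceMassHop_posDef Nf S U mq hm
  have hR : (Matrix.reindex sliceQuarkEquiv sliceQuarkEquiv (fermionSliceMatrix U mq)).PosDef := by
    rw [Matrix.reindex_apply]
    exact hM.submatrix sliceQuarkEquiv.symm.injective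
  have hΓ := fockLift_posDef (SliceFermiIdx Nf S) _ hR
  have hdet : (0 : ℂ) < (sliceMassHop U mq).det ^ 2 := pow_pos hA.det_pos 2
  unfold fermionSliceOp
  exact hΓ.smul hdet

/-- **The `T̂_F`-weighted pairing is non-negative on the diagonal**: for all `m_f > −1` and every wave function
`Ψ` of the spatial links with values in the slice Fock space, `Re 𝔫(Ψ, Ψ) = Re ∫ ⟨Ψ(U), T̂_F(U) Ψ(U)⟩ dU ≥ 0`
(pointwise `⟨v, T̂_F(U) v⟩ ≥ 0` by `fermionSliceOp_posDef`; if the integrand is not integrable the Bochner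
integral is `0`).  This makes the denominator of the Rayleigh quotient `transferRayleigh` sign-definite.
[cite: Luscher1977, pp. 283–292] [cite: Smit2023, §6.5 (6.87)] -/
theorem fermionWeightForm_self_re_nonneg (Nf S : ℕ) [NeZero S] (mq : Fin Nf → ℝ) (hm : ∀ f, -1 < mq f)
    (Ψ : SliceWave Nf S) : 0 ≤ (fermionWeightForm mq Ψ Ψ).re := by
  have hpt : ∀ U : GaugeConfig 3 S (Matrix.specialUnitaryGroup (Fin 3) ℂ),
      0 ≤ star (Ψ U) ⬝ᵥ (fermionSliceOp U mq *ᵥ Ψ U) := fun U =>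
    (fermionSliceOp_posDef Nf S U mq hm).posSemidef.dotProduct_mulVec_nonneg (Ψ U)
  rw [fermionWeightForm]
  by_cases hint : Integrable (fun U => star (Ψ U) ⬝ᵥ (fermionSliceOp U mq *ᵥ Ψ U)) (sliceHaar S)
  · have hre : (∫ U, star (Ψ U) ⬝ᵥ (fermionSliceOp U mq *ᵥ Ψ U) ∂(sliceHaar S)).re =
        ∫ U, (star (Ψ U) ⬝ᵥ (fermionSliceOp U mq *ᵥ Ψ U)).re ∂(sliceHaar S) := by
      have h := integral_re hint
      simp only [RCLike.re_to_complex] at h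
      exact h.symm
    rw [hre]
    exact integral_nonneg fun U => (Complex.nonneg_iff.mp (hpt U)).1
  · rw [integral_undef hint, Complex.zero_re]

end Summit.QuantumFields.QCD.Cruxes.StableActionBridge.Sketch

end
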